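import Literature.MathematicalPhysics.QuantumFieldTheory.Balaban1983to89.B8LeafModelZd3
import Literature.MathematicalPhysics.QuantumFieldTheory.Balaban1983to89.B8Thm4TruncationLocal
import Literature.MathematicalPhysics.QuantumFieldTheory.Balaban1983to89.B8Prop5ContractionKLevel

/-!
# `Balaban1983to89.B8Prop5SocketDatum` — [Balaban1985RegularSpaces] pp. 88–89, 93–94: THE DATUM SIDE of the Proposition-5 socket
# `B8LeafModelZdOfHFP.SockHFP` — what the inductive datum `(u₁, U₁ = U′^{u₁⁻¹} = e^{iηA})` of Theorem 4 supplies to the Sect. D/E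
# fixed-point assembly (`B8Prop5JoinSectELocal.hFP_kLevel_of_sectE_local'`): the masked exponent, **(1.69) FROM (1.67)–(1.68) BY
# PROPOSITION 3** (the level-uniform GRADIENT member the datum does not display), the (−2)-weighted bound of `D*A`, the LIFT of (1.29)
# from the truncated to the full structure (index law №8), and the LOCALITY of the axial class `Ax_k(𝔅_k, U₀)` on the towers

statement-level skeleton of published theorems with citation tags; proofs where landed; nothing here is a claim about the
Yang–Mills mass gap

PDF held: `paper:balaban1985-cmp99-regular-spaces-gauge-fixing` (journal page = PDF page + 74); p. 88 ((1.67)–(1.69), «Proposition 3 implies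
that it is enough to prove (1.37), (1.38) and (1.67)», «they imply the same conditions for k − 1»), p. 89 («we take Λ_{k−1} ∪ B(Λ_k) as
Λ_{k−1}»), p. 93 ((1.99)–(1.103)), p. 94 (Proposition 5: «for an arbitrary configuration U₁ satisfying (1.69)»), p. 87 (Proposition 3).

WHY THIS FILE (cell `pub-ymgap`, seat `pub-ymgap-dag-n05-a` g6, KNIT seat of DAG node N05 = [B8]; count-neutral; bus line
[DAGN05A-G6-LOCATED-1]).  The leaf-level Prop-5 socket `SockHFP` (g5) displays its level-`m` datum as Theorem 4's driver hands it over: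
`u₁` unitary, `= 1` off `Ω₀`, `U₁^{u₁} = U′`, (1.29) at `m` levels for the TRUNCATED structure `Λs m`, the Landau condition of record
at `m` levels, and `U₁ = e^{iηA}`, `A` Hermitian, `|A| ≤ c⋆(Lʲη)⁻¹` on the sides of the plaquettes touching `Ω_j`, `j ≤ m` — print's
(1.67)–(1.68).  The provider (Sect. D/E, seats n04-b/n19-b) needs print's (1.69): the SAME with the GRADIENT member `|∇^η_{U₀}A| ≤
c⋆(Lʲη)⁻²` (it enters the source term `D*A` of (1.93)/(1.99), `hDA` of the JOIN with a level-uniform constant).  Print, p. 88: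
«Proposition 3 implies that it is enough to prove (1.37), (1.38) and (1.67)» — i.e. (1.69) is REGENERATED at every level from the
inductive data by Proposition 3.  §3 does exactly that at level `m ≥ 1` on the concrete `ℤᵈ × 𝔸` carriers: (1.40) from the socket's
`𝔄`-antecedents (gauge invariance + locality), (1.41) = the datum, (1.42) = the Landau clause of the datum + the (1.37)-clause by the
(1.42) LEMMA `B8Eq142KLevelLocal.H42_of_inAx` (from the socket's own (1.35)/(1.19)/(1.29) antecedents), the five (1.59) lines from the
Prop.-3-frame b9 socket AT LEVEL `m` (`B8LeafModelZd3.SockB9P3 … m …` — the knit's ONE b9 target «∀ m ≤ k, SockB9P3 … m …» thus serves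
Theorem 4's Prop-5 side too), then n05-b's `B8Prop3KLevel.prop3_norms_kLevel` ⇒ `(Lʲη)²|∇^η_{U₀}A′| ≤ 5dLB₀(α₀ + α₁) = c⋆` on the sides
of the plaquettes touching `Ω_j`, `j ≤ m`, for the MASKED exponent `A′` (= `A` there, `0` elsewhere — the JOIN wants a globally
Hermitian exponent; §2).  §4 turns it into the JOIN's `hDA`: `Bd2 L η (m+1) Ω (D*A′) (d·L²·c⋆)` (on `Ω_{m+1}` only the level-`m` weight
is available — p. 88 «It is clear from (1.69) that we have to improve the bounds on the domain Ω_k»).  §5: the JOIN runs at `m + 1` levels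
for the FULL structure `Λs (m+1)` and wants (1.29) for `u₁` there, while the datum has it for the truncation `Λs m`; under the TRUNCATION
LAW (index law №8: `Λs m j = Λs (m+1) j` for `j < m`, `Λs m m = Λs (m+1) m ∪ B(Λs (m+1) (m+1))`) this is `B8Thm4TruncationLocal.
restr129_truncate_iff_cond168` + `B8Eq178Averages.restr129_of_cond168` («hence u₁ satisfies the conditions (1.29)», p. 90).  §1: the
axial class (1.19) reads a configuration only on the bonds of the towers `Bʲ(y)`, `y ∈ Λ_j` (locality of the averages (43) and of the
tree contours) — the transfer the JOIN's `hAx` needs from `U′ = U₁^{u₁}` to `(e^{iηA′})^{u₁}`.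

WHAT IS PROVED (kernel, 0 sorry, theorems only): §1 `inAx_congr_of_towers`; §2 `exists_masked_datum`; §3 **`grad_bound_of_datum`**
((1.69) from (1.67)–(1.68) by Prop. 3 at level `m ≥ 1`, modulo `SockB9P3` at level `m`), `grad_bound_trivial` (the weight-free bound
`η²|∇A′| ≤ 2α₂`, enough at level `0`); §4 `norm_covDeriv_eq_norm_covDerivFwd`, `norm_covDivB_le`, **`bd2_covDivB_of_grad`**; §5
**`restr129_succ_of_truncation`**; §6 `sideTouches_pair_of_mem`, `sideTouches_of_tower_bond` (the JOIN's `hEbΩ`/`hEbT` at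
`Eb j := {b | SideTouches (Ω j) b}`).

HONEST SCOPE.  Datum-side bookkeeping + ONE print-located estimate ((1.69) via Prop. 3, by name over n05-b's k-level Prop. 3 and the (1.42)
lemma); nothing of Proposition 5's contraction, of [4]'s letters, or of [4] Thm 3.3 is proved (the b9 socket at level `m` is a
hypothesis); windows displayed as hypotheses (the assembler discharges them from one threshold, cf. `B8LeafModelZd3.prop3_windows`,
`B8Thm4Windows`).  Count-neutral; N05 NOT discharged; nothing continuum / ℝ⁴ / OS / mass-gap / Clay.  Unit `pub-ymgap-dag-n05-a` (g6),
2026-08-26.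
-/

noncomputable section

open NormedSpace
open scoped BigOperators

namespace Literature.MathematicalPhysics.QuantumFieldTheory.Balaban1983to89.B8Prop5SocketDatum

open Complex (I)
open B7Prop1Explicit B7Prop2Explicit B7Prop1Local B7Eq92Concrete
open B7Prop2Explicit (C0 c2')
open B7Prop3Flat (c3)
open B7Eq78Linearization (conjR conjR_sub conjR_smul_real)
open B8Ineq132 (covDerivFwd covDeriv InAk BondTouches Under norm_conjR conjR_conjR one_conjR)
open B8Eq119TwistedAxial (Restr129 InAx inAx_iff)
open B8Eq184Proof (cfgExp)
open B8Lemma1NonAbelian (mulCfg)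
open B8Eq140Level (SideTouches sideTouches_of_bondTouches)
open B8Eq146AExpansion (iEta expCfg)
open B7Prop4GeneralLevels (logCovIter linCovIter)
open B8Eq155JBound (Jcur wsup expCfg_iEta_mem_unitaryUnits)
open B8ScaledSupNorm (bondNorm msup weight Bdd)
open B8Ineq130 (tlo thi block_mem smul_mem inBox_of_le axialFn_congr agree_level)
open B8Thm2LogB (blockTop)
open B8Eq106Local (under_iff_tower)
open B8Eq138LandauZd (IsLandau138W covDivB covLap)
open B8Prop3GaugeFixedKLevel (mem_unitaryUnits_of_mgauge_eq mulCfg_eq_gaugeAct_of_mgauge_eq inAk_congr_of_sideTouches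
  expCfg_iEta_eq_cfgExp cfgExp_congr_at)
open B8LeafModelZd3 (SockB9P3)
open B8Thm4TruncationLocal (restr129_truncate_iff_cond168)
open B8Eq178Averages (restr129_of_cond168)
open B8Prop5ContractionKLevel (Bd2)
open B8LambdaSpaceKLevel (wt)
open QuantumLattice (blockSites)

-- `Site` alone could resolve to the torus sites of `Setup.lean`; re-export the `ℤ^d` sites of `B7Prop1Explicit`.
export B7Prop1Explicit (Site)

variable {d : ℕ}

/-! ## §1 LOCALITY OF THE AXIAL CLASS `Ax_k(𝔅_k, U₀)` (1.19): it reads the configuration on the bonds of the towers only -/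

section AxLocal

variable {𝔸 : Type*} [CStarAlgebra 𝔸]

/-- **`Ax_k(𝔅_k, U₀)` is LOCAL ON THE TOWERS**: if `W` and `W′` agree on every bond with both end-points in a tower `Bʲ(y)`, `y ∈ Λ_j`,
`1 ≤ j ≤ k` (`AgreeOn (tlo L y j) (thi L y j) W W′`), then `W ∈ Ax_k(𝔅_k, U₀) ⟺ W′ ∈ Ax_k(𝔅_k, U₀)` — the axial conditions (1.19) read
the `n`-fold averages (43) on the blocks under the tower sites (locality of (43), [Balaban1985Averaging] p. 24, `B8Ineq130.agree_level`)
along tree contours inside those blocks (`axialFn_congr`). [cite: Balaban1985RegularSpaces, (1.19)–(1.20) p.79, (1.34) p.82; Balaban1985Averaging, p.24] -/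
theorem inAx_congr_of_towers {L : ℕ} (hL : 1 ≤ L) (k : ℕ) (Λ : ℕ → Set (Site d)) (U₀ W W' : Site d → Fin d → 𝔸ˣ)
    (h : ∀ j, 1 ≤ j → j ≤ k → ∀ y ∈ Λ j, AgreeOn (tlo L y j) (thi L y j) W W') :
    InAx L k Λ U₀ W ↔ InAx L k Λ U₀ W' := by
  have key : ∀ {V V' : Site d → Fin d → 𝔸ˣ}, (∀ j, 1 ≤ j → j ≤ k → ∀ y ∈ Λ j, AgreeOn (tlo L y j) (thi L y j) V V') →
      ∀ j, 1 ≤ j → j ≤ k → ∀ y ∈ Λ j, ∀ n, n < j → ∀ z : Site d, Under L (j - (n + 1)) y z → ∀ r : Fin d → Fin L,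
        axialFn (avgIter L V n) ((L : ℤ) • z) ((L : ℤ) • z + boxVec L r) =
          axialFn (avgIter L V' n) ((L : ℤ) • z) ((L : ℤ) • z + boxVec L r) := by
    intro V V' hVV j hj1 hjk y hy n hn z hz r
    have hA : AgreeOn (tlo L y (j - n)) (thi L y (j - n)) (avgIter L V n) (avgIter L V' n) :=
      agree_level hL n (j - n) (by rw [Nat.sub_add_cancel hn.le]; exact hVV j hj1 hjk y hy)
    obtain ⟨hz1, hz2⟩ := (under_iff_tower L (j - (n + 1)) y z).1 hz
    obtain ⟨h1, h2⟩ := block_mem hz1 hz2 r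
    obtain ⟨h3, h4⟩ := smul_mem hL hz1 hz2
    rw [show j - (n + 1) + 1 = j - n by omega] at h1 h2 h3 h4
    exact axialFn_congr hA _ _ (inBox_of_le h3 h4) (inBox_of_le h1 h2)
  rw [inAx_iff, inAx_iff]
  constructor
  · intro H j hj1 hjk y hy n hn z hz r
    rw [← key h j hj1 hjk y hy n hn z hz r]
    exact H j hj1 hjk y hy n hn z hz r
  · intro H j hj1 hjk y hy n hn z hz r
    rw [key h j hj1 hjk y hy n hn z hz r]
    exact H j hj1 hjk y hy n hn z hz r

end AxLocal

/-! ## §2 THE MASKED EXPONENT of the datum (globally Hermitian, `= A` on the touched bonds, `0` elsewhere) -/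

section Mask

variable {𝔸 : Type*} [CStarAlgebra 𝔸]

/-- **The masked exponent.**  For a datum `U₁ = e^{iηA}` with `A` Hermitian and `|A| ≤ c(Lʲη)⁻¹` on the sides of the plaquettes touching
`Ω_j`, `j ≤ m`, there is a GLOBALLY Hermitian `A′` equal to `A` on those bonds and `0` elsewhere; in particular `U₁ = e^{iηA′}` with the
same bounds there (the shape `B8Eq142KLevelLocal.H42_of_inAx`, `B8LeafModelZd3.SockB9P3` and the JOIN read).
[cite: Balaban1985RegularSpaces, (1.67)–(1.69) p.88, (1.41) p.83] -/
theorem exists_masked_datum {L : ℕ} {η c : ℝ} {m : ℕ} {Ω : ℕ → Set (Site d)} {U₁ : Site d → Fin d → 𝔸ˣ} {A : Site d → Fin d → 𝔸}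
    (hdat : ∀ j, j ≤ m → ∀ b ∈ {b : Site d × Fin d | SideTouches (Ω j) b.1 b.2},
      U₁ b.1 b.2 = cfgExp η A b.1 b.2 ∧ IsSelfAdjoint (A b.1 b.2) ∧ ‖A b.1 b.2‖ ≤ c * ((L : ℝ) ^ j * η)⁻¹) :
    ∃ A' : Site d → Fin d → 𝔸, (∀ y τ, IsSelfAdjoint (A' y τ)) ∧
      (∀ j, j ≤ m → ∀ (y : Site d) (τ : Fin d), SideTouches (Ω j) y τ → A' y τ = A y τ) ∧
      (∀ j, j ≤ m → ∀ (y : Site d) (τ : Fin d), SideTouches (Ω j) y τ →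
        U₁ y τ = cfgExp η A' y τ ∧ ‖A' y τ‖ ≤ c * ((L : ℝ) ^ j * η)⁻¹) ∧
      (∀ (y : Site d) (τ : Fin d), (∀ j, j ≤ m → ¬ SideTouches (Ω j) y τ) → A' y τ = 0) := by
  classical
  refine ⟨fun y τ => if ∃ j, j ≤ m ∧ SideTouches (Ω j) y τ then A y τ else 0, fun y τ => ?_, fun j hj y τ hs => ?_,
    fun j hj y τ hs => ?_, fun y τ h => ?_⟩
  · dsimp only
    by_cases hmem : ∃ j, j ≤ m ∧ SideTouches (Ω j) y τ
    · rw [if_pos hmem]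
      obtain ⟨j, hj, hs⟩ := hmem
      exact (hdat j hj (y, τ) hs).2.1
    · rw [if_neg hmem]
      exact IsSelfAdjoint.zero 𝔸
  · dsimp only
    exact if_pos (show ∃ j, j ≤ m ∧ SideTouches (Ω j) y τ from ⟨j, hj, hs⟩)
  · dsimp only
    have hA : (if ∃ j, j ≤ m ∧ SideTouches (Ω j) y τ then A y τ else 0) = A y τ :=
      if_pos (show ∃ j, j ≤ m ∧ SideTouches (Ω j) y τ from ⟨j, hj, hs⟩)
    obtain ⟨hexp, -, hbd⟩ := hdat j hj (y, τ) hs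
    refine ⟨?_, by rw [hA]; exact hbd⟩
    rw [hexp]
    exact cfgExp_congr_at η hA.symm
  · dsimp only
    exact if_neg fun ⟨j, hj, hs⟩ => h j hj hs

end Mask

/-! ## §3 (1.69) FROM (1.67)–(1.68) BY PROPOSITION 3 at level `m ≥ 1` -/

section Grad

variable {𝔸 : Type*} [CStarAlgebra 𝔸] [Nontrivial 𝔸]

/-- **The weight-free gradient bound** (enough at level `0`): a globally Hermitian exponent with `|A′| ≤ α₂(Lʲη)⁻¹` on the sides of the
plaquettes touching `Ω_j` (`j ≤ m`) and `A′ = 0` elsewhere has `|A′| ≤ α₂η⁻¹` everywhere, hence `|∇^η_{U₀,κ}A′_τ| ≤ 2α₂η⁻²` everywhere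
(unitary transport), i.e. `η²|∇A′| ≤ 2α₂`. [cite: Balaban1985RegularSpaces, (1.69) p.88, (1.1) p.76] -/
theorem grad_bound_trivial {η : ℝ} (hη : 0 < η) {L : ℕ} (hL : 1 ≤ L) {m : ℕ} {Ω : ℕ → Set (Site d)} {U₀ : Site d → Fin d → 𝔸ˣ}
    (hU₀ : ∀ x κ, U₀ x κ ∈ unitaryUnits 𝔸) {A' : Site d → Fin d → 𝔸} {α₂ : ℝ} (hα₂ : 0 ≤ α₂)
    (h41 : ∀ j, j ≤ m → ∀ (y : Site d) (τ : Fin d), SideTouches (Ω j) y τ → ‖A' y τ‖ ≤ α₂ * ((L : ℝ) ^ j * η)⁻¹)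
    (hA0 : ∀ (y : Site d) (τ : Fin d), (∀ j, j ≤ m → ¬ SideTouches (Ω j) y τ) → A' y τ = 0)
    (y : Site d) (κ τ : Fin d) : η ^ 2 * ‖covDerivFwd η U₀ κ (fun z => A' z τ) y‖ ≤ 2 * α₂ := by
  have hLr : (1 : ℝ) ≤ L := by exact_mod_cast hL
  have hU₀1 : ∀ x κ, U₀ x κ ∈ U1 𝔸 := fun x κ => unitaryUnits_le_U1 (hU₀ x κ)
  have hAglob : ∀ y τ, ‖A' y τ‖ ≤ α₂ * η⁻¹ := by
    intro y τ
    by_cases hmem : ∃ j, j ≤ m ∧ SideTouches (Ω j) y τ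
    · obtain ⟨j, hj, hs⟩ := hmem
      have hLj : (1 : ℝ) ≤ (L : ℝ) ^ j := one_le_pow₀ hLr
      calc ‖A' y τ‖ ≤ α₂ * ((L : ℝ) ^ j * η)⁻¹ := h41 j hj y τ hs
        _ = α₂ * η⁻¹ * ((L : ℝ) ^ j)⁻¹ := by rw [mul_inv]; ring
        _ ≤ α₂ * η⁻¹ * 1 := by
            apply mul_le_mul_of_nonneg_left (inv_le_one_of_one_le₀ hLj) (by positivity)
        _ = α₂ * η⁻¹ := mul_one _
    · rw [hA0 y τ fun j hj hs => hmem ⟨j, hj, hs⟩, norm_zero]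
      positivity
  have hgrad : ‖covDerivFwd η U₀ κ (fun z => A' z τ) y‖ ≤ 2 * α₂ * η⁻¹ * η⁻¹ := by
    unfold covDerivFwd
    rw [norm_smul, norm_inv, Real.norm_eq_abs, abs_of_pos hη]
    have h1 : ‖conjR (U₀ y κ) (A' (y + e κ) τ) - A' y τ‖ ≤ α₂ * η⁻¹ + α₂ * η⁻¹ := by
      calc ‖conjR (U₀ y κ) (A' (y + e κ) τ) - A' y τ‖
          ≤ ‖conjR (U₀ y κ) (A' (y + e κ) τ)‖ + ‖A' y τ‖ := norm_sub_le _ _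
        _ ≤ α₂ * η⁻¹ + α₂ * η⁻¹ := by
            rw [norm_conjR (hU₀1 y κ)]
            exact add_le_add (hAglob _ _) (hAglob _ _)
    calc η⁻¹ * ‖conjR (U₀ y κ) (A' (y + e κ) τ) - A' y τ‖ ≤ η⁻¹ * (α₂ * η⁻¹ + α₂ * η⁻¹) :=
        mul_le_mul_of_nonneg_left h1 (by positivity)
      _ = 2 * α₂ * η⁻¹ * η⁻¹ := by ring
  calc η ^ 2 * ‖covDerivFwd η U₀ κ (fun z => A' z τ) y‖ ≤ η ^ 2 * (2 * α₂ * η⁻¹ * η⁻¹) :=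
      mul_le_mul_of_nonneg_left hgrad (by positivity)
    _ = 2 * α₂ := by field_simp

/-- **(1.69) FROM (1.67)–(1.68) BY PROPOSITION 3 AT LEVEL `m ≥ 1`** (p. 88 «Proposition 3 implies that it is enough to prove (1.37), (1.38)
and (1.67)»; Prop. 5, p. 94: «for an arbitrary configuration U₁ satisfying (1.69)»).  SETTING (the antecedents of the leaf socket
`B8LeafModelZdOfHFP.SockHFP` at a member with `K` levels, region sequence `Ω` (antitone), constraint structures `Λs m′`, constraint-bond classes
`Λb m′` with `hbox`/`hclass`): `U₀, U′` unitary with (1.33) `InAk … U₀`, (1.34) `InAk … (U′U₀)` + `InAx L m′ (Λs m′) U₀ (U′U₀)` for all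
`m′ ≤ K`, (1.35)/(1.66) box-closeness `≤ α₁`; the DATUM at level `m` (`1 ≤ m ≤ K`): `u₁` unitary, `U₁^{u₁} = U′` (`mgauge U₀ u₁ U₁ = U′`),
(1.29) `Restr129 L m (Λs m) U₀ u₁`, the Landau condition of record `IsLandau138W L m …  U₁`, and a globally Hermitian exponent `A′` with
`U₁ = e^{iηA′}`, `|A′| ≤ α₂(Lʲη)⁻¹` on the sides of the plaquettes touching `Ω_j` (`j ≤ m`), `A′ = 0` elsewhere (§2); the Prop.-3-frame b9
socket AT LEVEL `m` (`SockB9P3 … m Ω Λs Λb`, which reads `Λs m`, `Λb m`; [4] Thm 3.3) below whose threshold `α₀, α₂` lie; Prop. 3's windows at `(α₀, α₂)`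
incl. (1.61) `2α₂² + 20dα₀α₂ + 2C₂α₂² ≤ α₀ + α₁`, and `dLα₁ ≤ 1/8`.  CONCLUSION — the gradient member of (1.69)/(1.36)₂ with `B₁ = 5dLB₀`:
`(Lʲη)²|(∇^η_{U₀,κ}A′_τ)(y)| ≤ 5dLB₀(α₀ + α₁)` for every side `⟨y, y + e_τ⟩` of a plaquette touching `Ω_j`, `j ≤ m`, every `κ`.  PROOF
(by name): (1.40)₁ for `e^{iηA′}U₀` from `InAk (U′U₀)` by gauge invariance (`u₁`) and locality; the (1.42)/(1.37) clause on `Λb m` by the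
(1.42) LEMMA `B8Eq142KLevelLocal.H42_of_inAx`; the five (1.59) lines from the socket; n05-b's `B8Prop3KLevel.prop3_norms_kLevel` at `m`
levels on the bounded gradient family. [cite: Balaban1985RegularSpaces, (1.67)–(1.69) p.88, Prop. 3 p.87, (1.40)–(1.42) p.83, (1.59)–(1.62) pp.86–87, Prop. 5 p.94] -/
theorem grad_bound_of_datum (hd2 : 2 ≤ d) {η : ℝ} (hη : 0 < η) {L : ℕ} (hL : 2 ≤ L) (K : ℕ)
    {U₀ U' : Site d → Fin d → 𝔸ˣ} (hU₀ : ∀ x κ, U₀ x κ ∈ unitaryUnits 𝔸) (hU' : ∀ x κ, U' x κ ∈ unitaryUnits 𝔸)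
    {α₀ α₁ α₂ B₀ B₀β C₂ cB9 β : ℝ} {len : Site d → ℝ} (hα₀ : 0 < α₀) (hα₁ : 0 < α₁) (hα₂ : 0 < α₂) (hB₀ : 0 ≤ B₀)
    -- Prop. 3's windows at `(α₀, α₂)` (cf. `B8LeafModelZd3.prop3_windows`), (1.61), and `dLα₁ ≤ 1/8`
    (hα3 : C0 d * α₀ ≤ 1 / 3) (hα4 : 4 * α₀ ≤ c2' d L) (h16 : 16 * α₂ ≤ 1) (hd5 : 5 * α₂ * ((d : ℝ) - 1) ≤ 4)
    (hsmall : Real.exp (4 * (800 * ((d : ℝ) + 1) ^ 2 * ((d : ℝ) + 4)) * α₀) * (1 + 8 * (131072 * ((d : ℝ) + 1) ^ 2) * α₂) ≤ 2)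
    (hc₃ : 2 * α₂ ≤ c3 d L) (hside : 36 * d * B₀ * α₂ ≤ 1 / 2) (h50 : 50 * d * α₂ ≤ 1)
    (hC₂ : 8 * (131072 * ((d : ℝ) + 1) ^ 2) * Real.exp (4 * (800 * ((d : ℝ) + 1) ^ 2 * ((d : ℝ) + 4)) * α₀) ≤ C₂)
    (h61 : 2 * α₂ ^ 2 + 20 * d * α₀ * α₂ + 2 * C₂ * α₂ ^ 2 ≤ α₀ + α₁) (hsmall₁ : (d : ℝ) * L * α₁ ≤ 1 / 8)
    -- the member's geometry
    (Ω : ℕ → Set (Site d)) (hΩ : ∀ j, Ω (j + 1) ⊆ Ω j) (Λs : ℕ → ℕ → Set (Site d)) (Λb : ℕ → ℕ → Set (Site d × Fin d))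
    (hbox : ∀ m, m ≤ K → ∀ j, j ≤ m → ∀ c ∈ Λb m j, ∀ x, InBox (loK L j c.1) (bondHiK L j c.1 c.2) x → x ∈ Ω j)
    (hclass : ∀ m, m ≤ K → ∀ j, j ≤ m → ∀ c ∈ Λb m j,
      (c.1 ∈ Λs m j ∧ c.1 + e c.2 ∈ Λs m j) ∨
      (∃ j', j = j' + 1 ∧ (∀ x, (L : ℤ) • c.1 ≤ x → x ≤ (L : ℤ) • c.1 + blockTop L → x ∈ Λs m j') ∧ c.1 + e c.2 ∈ Λs m j) ∨
      (∃ j', j = j' + 1 ∧ c.1 ∈ Λs m j ∧ (∀ x, (L : ℤ) • (c.1 + e c.2) ≤ x → x ≤ (L : ℤ) • (c.1 + e c.2) + blockTop L → x ∈ Λs m j')))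
    -- the socket's antecedents: (1.33), (1.34), (1.35)/(1.66)
    (h33 : InAk L K η α₀ Ω U₀) (h34 : InAk L K η α₀ Ω (mulCfg U' U₀)) (hAx : ∀ m, m ≤ K → InAx L m (Λs m) U₀ (mulCfg U' U₀))
    (h135 : ∀ j, j ≤ K → ∀ (z : Site d) (μ : Fin d), (∀ x, InBox (loK L j z) (bondHiK L j z μ) x → x ∈ Ω j) →
      ‖(avgIter L (mulCfg U' U₀) j z μ : 𝔸) - (avgIter L U₀ j z μ : 𝔸)‖ ≤ α₁)
    -- the b9 socket in Proposition 3's frame AT LEVEL `m`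
    {m : ℕ} (hm1 : 1 ≤ m) (hmK : m ≤ K)
    (SB9 : SockB9P3 (𝔸 := 𝔸) L B₀ B₀β cB9 β len η m Ω Λs Λb) (hα₀9 : α₀ ≤ cB9) (hα₂9 : α₂ ≤ cB9)
    -- the datum at level `m`, with its masked exponent
    {u₁ : Site d → 𝔸ˣ} {U₁ : Site d → Fin d → 𝔸ˣ} {A' : Site d → Fin d → 𝔸}
    (hu₁ : ∀ x, u₁ x ∈ unitaryUnits 𝔸) (hW : mgauge U₀ u₁ U₁ = U') (h129 : Restr129 L m (Λs m) U₀ u₁)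
    (hLan : IsLandau138W L m η (Ω 0) (Λs m) U₀ U₁) (hsa : ∀ y τ, IsSelfAdjoint (A' y τ))
    (hWA : ∀ j, j ≤ m → ∀ (y : Site d) (τ : Fin d), SideTouches (Ω j) y τ →
      U₁ y τ = cfgExp η A' y τ ∧ ‖A' y τ‖ ≤ α₂ * ((L : ℝ) ^ j * η)⁻¹)
    (hA0 : ∀ (y : Site d) (τ : Fin d), (∀ j, j ≤ m → ¬ SideTouches (Ω j) y τ) → A' y τ = 0) :
    ∀ j, j ≤ m → ∀ (y : Site d) (κ τ : Fin d), SideTouches (Ω j) y τ →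
      ((L : ℝ) ^ j * η) ^ 2 * ‖covDerivFwd η U₀ κ (fun z => A' z τ) y‖ ≤ 5 * d * L * B₀ * (α₀ + α₁) := by
  have hL1 : 1 ≤ L := le_trans (by norm_num) hL
  have hLr : (1 : ℝ) ≤ L := by exact_mod_cast hL1
  have hU₀1 : ∀ x κ, U₀ x κ ∈ U1 𝔸 := fun x κ => unitaryUnits_le_U1 (hU₀ x κ)
  -- the datum is unitary-valued; its class (1.40)₁ by gauge invariance and locality
  have hWu : ∀ x κ, U₁ x κ ∈ unitaryUnits 𝔸 := mem_unitaryUnits_of_mgauge_eq hU₀ hU' hu₁ hW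
  have h33m : InAk L m η α₀ Ω U₀ := fun j hj => h33 j (hj.trans hmK)
  have h34W : InAk L m η α₀ Ω (mulCfg U₁ U₀) := by
    have h1 : InAk L m η α₀ Ω (mulCfg U' U₀) := fun j hj => h34 j (hj.trans hmK)
    have hui : ∀ x, u₁⁻¹ x ∈ U1 𝔸 := fun x => unitaryUnits_le_U1 ((unitaryUnits 𝔸).inv_mem (hu₁ x))
    rw [mulCfg_eq_gaugeAct_of_mgauge_eq hW]
    exact (B8Ineq132.inAk_gaugeAct_iff L m η α₀ Ω hui _).2 h1
  have h40₁ : InAk L m η α₀ Ω (mulCfg (expCfg (iEta η A')) U₀) := by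
    refine (inAk_congr_of_sideTouches L m η α₀ (V := mulCfg U₁ U₀) fun j hj y τ hs => ?_).1 h34W
    show U₁ y τ * U₀ y τ = expCfg (iEta η A') y τ * U₀ y τ
    rw [(hWA j hj y τ hs).1, expCfg_iEta_eq_cfgExp]
  have h41' : ∀ j, j ≤ m → ∀ (y : Site d) (τ : Fin d), SideTouches (Ω j) y τ → ‖A' y τ‖ ≤ α₂ * ((L : ℝ) ^ j * η)⁻¹ :=
    fun j hj y τ hs => (hWA j hj y τ hs).2
  -- the gradient datum (bounded family) and its supremum `g`
  have hgrad : ∀ (y : Site d) (κ τ : Fin d), ‖covDerivFwd η U₀ κ (fun z => A' z τ) y‖ ≤ 2 * α₂ * η⁻¹ * η⁻¹ := by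
    intro y κ τ
    have h := grad_bound_trivial hη hL1 hU₀ hα₂.le h41' hA0 y κ τ
    have hη2 : 0 < η ^ 2 := by positivity
    rw [show 2 * α₂ * η⁻¹ * η⁻¹ = 2 * α₂ / η ^ 2 by field_simp, le_div_iff₀ hη2, mul_comm]
    exact h
  have hBg : Bdd L m η (-(2 : ℝ)) (fun j (t : Fin d × Fin d × Site d) => SideTouches (Ω j) t.2.2 t.2.1)
      (fun t => covDerivFwd η U₀ t.1 (fun z => A' z t.2.1) t.2.2) := by
    have e2 : (-(2 : ℝ)) = -((2 : ℕ) : ℝ) := by norm_num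
    rw [e2]
    refine B8ScaledSupNorm.bdd_of_forall (c := 2 * α₂ * ((L : ℝ) ^ m) ^ 2) fun j hj t _ => ?_
    rw [B8ScaledSupNorm.weight_neg_natCast L η 2 j]
    have hLjm : (L : ℝ) ^ j ≤ (L : ℝ) ^ m := pow_le_pow_right₀ hLr hj
    have hLj0 : (0 : ℝ) ≤ (L : ℝ) ^ j := by positivity
    calc ((L : ℝ) ^ j * η) ^ 2 * ‖covDerivFwd η U₀ t.1 (fun z => A' z t.2.1) t.2.2‖
        ≤ ((L : ℝ) ^ j * η) ^ 2 * (2 * α₂ * η⁻¹ * η⁻¹) := mul_le_mul_of_nonneg_left (hgrad _ _ _) (by positivity)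
      _ = 2 * α₂ * ((L : ℝ) ^ j) ^ 2 := by field_simp
      _ ≤ 2 * α₂ * ((L : ℝ) ^ m) ^ 2 := by gcongr
  set g : ℝ := msup L m η (-(2 : ℝ)) (fun j (t : Fin d × Fin d × Site d) => SideTouches (Ω j) t.2.2 t.2.1)
      (fun t => covDerivFwd η U₀ t.1 (fun z => A' z t.2.1) t.2.2) with hg_def
  have hg0 : 0 ≤ g := B8ScaledSupNorm.msup_nonneg L m hη.le _ _ _
  have hg : ∀ j, j ≤ m → ∀ (y : Site d) (κ τ : Fin d), SideTouches (Ω j) y τ →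
      ((L : ℝ) ^ j * η) ^ 2 * ‖covDerivFwd η U₀ κ (fun z => A' z τ) y‖ ≤ g := by
    intro j hj y κ τ hs
    have h := B8ScaledSupNorm.weight_mul_norm_le_msup hBg hj (i := (κ, τ, y)) hs
    have hw : weight L η (-(2 : ℝ)) j = ((L : ℝ) ^ j * η) ^ 2 := by
      have e2 : (-(2 : ℝ)) = -((2 : ℕ) : ℝ) := by norm_num
      rw [e2, B8ScaledSupNorm.weight_neg_natCast L η 2 j]
    rw [hw] at h
    exact h
  -- the five (1.59) lines from the b9 socket at level `m`
  obtain ⟨h59a, h59g, h59j, h59l, -⟩ := SB9 α₀ α₂ hα₀ hα₀9 hα₂ hα₂9 U₀ U₁ hU₀ hWu h33m h34W hLan A' hsa hWA hA0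
  -- (1.42)/(1.37) on the constraint bonds of the `m`-truncation, by the (1.42) lemma
  have h42 : ∀ j, j ≤ m → ∀ c ∈ Λb m j, ‖logCovIter L U₀ (iEta η A') j c.1 c.2‖ < 2 * d * L * α₁ :=
    B8Eq142KLevelLocal.H42_of_inAx hd2 hη hL K hU₀ hα₀ hα₁ hα₂.le hα3 hα4 h16 hsmall hc₃ hsmall₁ Ω hΩ Λs Λb hbox hclass h33 h34 hAx
      h135 (fun m W => IsLandau138W L m η (Ω 0) (Λs m) U₀ W) m hm1 hmK u₁ U₁ A' hu₁ hW h129 hLan hsa hWA hA0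
  have hboxm : ∀ j, j ≤ m → ∀ c ∈ Λb m j, ∀ x, InBox (loK L j c.1) (bondHiK L j c.1 c.2) x → x ∈ Ω j :=
    fun j hj c hc x hx => hbox m hmK j hj c hc x hx
  -- PROPOSITION 3 at `m` levels (n05-b): the gradient member
  obtain ⟨-, hg', -, -⟩ := B8Prop3KLevel.prop3_norms_kLevel hd2 hη hL hU₀ hsa hα₀ hα₁.le hα₂.le hg0 hα3 hα4 h16 hd5 hsmall hc₃ hB₀
    hside h50 hC₂ h61 hboxm h33m h40₁ h41' hg h42 h59a h59g h59j h59l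
  intro j hj y κ τ hs
  exact (hg j hj y κ τ hs).trans hg'

end Grad

/-! ## §4 THE SOURCE TERM `D*A`: `(−2)`-weighted bound from the gradient member of (1.69) -/

section Divergence

variable {𝔸 : Type*} [CStarAlgebra 𝔸] [Nontrivial 𝔸]

/-- **`|(D^{η*}_{U₀,ν}F)(x)| = |(D^η_{U₀,ν}F)(x − e_ν)|`** for unitary-valued `U₀`: the backward covariant difference at `x` is
`−R(U₀(x − e_ν, ν))⁻¹` applied to the forward one at `x − e_ν`, and `R` of a unitary is isometric.
[cite: Balaban1985BackgroundPropagators, (3.23) p.394; Balaban1985RegularSpaces, (1.1)–(1.2) p.76] -/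
theorem norm_covDeriv_eq_norm_covDerivFwd {U₀ : Site d → Fin d → 𝔸ˣ} (hU₀ : ∀ x κ, U₀ x κ ∈ U1 𝔸) (η : ℝ) (ν : Fin d)
    (F : Site d → 𝔸) (x : Site d) : ‖covDeriv η U₀ ν F x‖ = ‖covDerivFwd η U₀ ν F (x - e ν)‖ := by
  have hu : U₀ (x - e ν) ν ∈ U1 𝔸 := hU₀ _ _
  have hui : (U₀ (x - e ν) ν)⁻¹ ∈ U1 𝔸 := (U1 𝔸).inv_mem hu
  have key : covDeriv η U₀ ν F x = -(conjR (U₀ (x - e ν) ν)⁻¹ (covDerivFwd η U₀ ν F (x - e ν))) := by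
    unfold covDeriv covDerivFwd
    rw [sub_add_cancel, conjR_smul_real, conjR_sub, conjR_conjR, inv_mul_cancel, one_conjR, ← smul_neg, neg_sub]
  rw [key, norm_neg, norm_conjR hui]

/-- **`|(D*A)(x)| ≤ Σ_μ |(D^η_{U₀,μ}A_μ)(x − e_μ)|`** (`covDivB = Σ_μ D^{η*}_μ A_μ`). [cite: Balaban1985BackgroundPropagators, (3.23) p.394] -/
theorem norm_covDivB_le {U₀ : Site d → Fin d → 𝔸ˣ} (hU₀ : ∀ x κ, U₀ x κ ∈ U1 𝔸) (η : ℝ) (A : Site d → Fin d → 𝔸) (x : Site d) :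
    ‖covDivB η U₀ A x‖ ≤ ∑ μ : Fin d, ‖covDerivFwd η U₀ μ (fun z => A z μ) (x - e μ)‖ := by
  unfold covDivB
  refine (norm_sum_le _ _).trans (le_of_eq (Finset.sum_congr rfl fun μ _ => ?_))
  exact norm_covDeriv_eq_norm_covDerivFwd hU₀ η μ _ x

/-- **The JOIN's `hDA` from the gradient member of (1.69)**: if `(Lʲη)²|(D^η_{U₀,κ}A′_τ)(y)| ≤ G` on the sides `⟨y, y + e_τ⟩` of the
plaquettes touching `Ω_j` for every `j ≤ m` (all `κ`), then `|D*A′|₍₋₂₎ ≤ d·L²·G` at `m + 1` levels: `(Lʲη)²|(D*A′)(x)| ≤ d·L²·G` for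
`x ∈ Ω_j`, `j ≤ m + 1` (`Bd2`).  For `j ≤ m` each of the `d` bonds `⟨x − e_μ, x⟩` touches `Ω_j` at `x`; on `Ω_{m+1} ⊂ Ω_m` only the
level-`m` weight is available and `(L^{m+1}η)² = L²(L^mη)²` (p. 88 «we have to improve the bounds on the domain Ω_k»).
[cite: Balaban1985RegularSpaces, (1.69) p.88, (1.99) p.93, p.86 (|·|₍₋₂₎)] -/
theorem bd2_covDivB_of_grad (hd2 : 2 ≤ d) {L : ℕ} (hL : 1 ≤ L) {η : ℝ} (hη : 0 < η) {m : ℕ} {Ω : ℕ → Set (Site d)}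
    (hΩ : ∀ j, Ω (j + 1) ⊆ Ω j) {U₀ : Site d → Fin d → 𝔸ˣ} (hU₀ : ∀ x κ, U₀ x κ ∈ unitaryUnits 𝔸) {A' : Site d → Fin d → 𝔸}
    {G : ℝ} (hG : 0 ≤ G)
    (hgrad : ∀ j, j ≤ m → ∀ (y : Site d) (κ τ : Fin d), SideTouches (Ω j) y τ →
      ((L : ℝ) ^ j * η) ^ 2 * ‖covDerivFwd η U₀ κ (fun z => A' z τ) y‖ ≤ G) :
    Bd2 L η (m + 1) Ω (covDivB η U₀ A') ((d : ℝ) * (L : ℝ) ^ 2 * G) := by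
  haveI : Nontrivial (Fin d) := Fin.nontrivial_iff_two_le.mpr hd2
  have hU₀1 : ∀ x κ, U₀ x κ ∈ U1 𝔸 := fun x κ => unitaryUnits_le_U1 (hU₀ x κ)
  have hLr : (1 : ℝ) ≤ L := by exact_mod_cast hL
  have hL2 : (1 : ℝ) ≤ (L : ℝ) ^ 2 := one_le_pow₀ hLr
  -- the level-`j` bound for `j ≤ m`, `x ∈ Ω_j`: `(Lʲη)²|D*A′(x)| ≤ d·G`
  have hlev : ∀ j, j ≤ m → ∀ x ∈ Ω j, ((L : ℝ) ^ j * η) ^ 2 * ‖covDivB η U₀ A' x‖ ≤ (d : ℝ) * G := by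
    intro j hj x hx
    have hw0 : 0 ≤ ((L : ℝ) ^ j * η) ^ 2 := by positivity
    calc ((L : ℝ) ^ j * η) ^ 2 * ‖covDivB η U₀ A' x‖
        ≤ ((L : ℝ) ^ j * η) ^ 2 * ∑ μ : Fin d, ‖covDerivFwd η U₀ μ (fun z => A' z μ) (x - e μ)‖ :=
          mul_le_mul_of_nonneg_left (norm_covDivB_le hU₀1 η A' x) hw0
      _ = ∑ μ : Fin d, ((L : ℝ) ^ j * η) ^ 2 * ‖covDerivFwd η U₀ μ (fun z => A' z μ) (x - e μ)‖ := Finset.mul_sum _ _ _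
      _ ≤ ∑ _μ : Fin d, G := Finset.sum_le_sum fun μ _ => ?_
      _ = (d : ℝ) * G := by simp
    -- the bond `⟨x − e_μ, x⟩` touches `Ω_j` at `x`
    obtain ⟨κ, hκ⟩ := exists_ne μ
    have hb : BondTouches (Ω j) (x - e μ) μ := Or.inr (by rw [sub_add_cancel]; exact hx)
    exact hgrad j hj (x - e μ) μ μ (sideTouches_of_bondTouches hκ hb)
  intro j hj x hx
  have hdG : (d : ℝ) * G ≤ (d : ℝ) * (L : ℝ) ^ 2 * G := by
    have : (d : ℝ) * G * 1 ≤ (d : ℝ) * G * (L : ℝ) ^ 2 := mul_le_mul_of_nonneg_left hL2 (by positivity)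
    linarith
  rcases Nat.lt_or_ge j (m + 1) with hjm | hjm
  · -- `j ≤ m`
    have h := hlev j (by omega) x hx
    unfold wt
    exact h.trans hdG
  · -- `j = m + 1`: use the level-`m` bound on `Ω_{m+1} ⊂ Ω_m`
    obtain rfl : j = m + 1 := le_antisymm hj hjm
    have hx' : x ∈ Ω m := hΩ m hx
    have h := hlev m le_rfl x hx'
    unfold wt
    have hw : ((L : ℝ) ^ (m + 1) * η) ^ 2 = (L : ℝ) ^ 2 * ((L : ℝ) ^ m * η) ^ 2 := by rw [pow_succ]; ring
    rw [hw, mul_assoc]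
    calc (L : ℝ) ^ 2 * (((L : ℝ) ^ m * η) ^ 2 * ‖covDivB η U₀ A' x‖) ≤ (L : ℝ) ^ 2 * ((d : ℝ) * G) :=
          mul_le_mul_of_nonneg_left h (by positivity)
      _ = (d : ℝ) * (L : ℝ) ^ 2 * G := by ring

end Divergence

/-! ## §5 (1.29) LIFTED from the truncated structure to the full one (index law №8) -/

section Lift

variable {𝔸 : Type*} [CStarAlgebra 𝔸]

/-- **«hence u₁ satisfies the conditions (1.29)»** (p. 90) at `m + 1` levels, from (1.29) at `m` levels for the TRUNCATED structure:
if `Λs m` is the truncation of `Λs (m+1)` — `Λs m j = Λs (m+1) j` for `j < m` and `Λs m m = Λs (m+1) m ∪ B(Λs (m+1) (m+1))` (p. 89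
«we take Λ_{k−1} ∪ B(Λ_k) as Λ_{k−1}»; index law №8 of the N05 prototype) — then `Restr129 L m (Λs m) U₀ u₁ → Restr129 L (m+1)
(Λs (m+1)) U₀ u₁` (the new top condition: the level-`m` averages of `u₁` are `1` on the blocks under `Λ_{m+1}`, so their one more average is `1`).
[cite: Balaban1985RegularSpaces, p.90 (sentence before (1.78)), (1.68) p.88, (1.29) p.81, p.89] -/
theorem restr129_succ_of_truncation {L : ℕ} (hL : 1 ≤ L) {m : ℕ} {Λs : ℕ → ℕ → Set (Site d)}
    (hlt : ∀ j, j < m → Λs m j = Λs (m + 1) j)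
    (htop : ∀ x, x ∈ Λs m m ↔ x ∈ Λs (m + 1) m ∨ ∃ y ∈ Λs (m + 1) (m + 1), x ∈ blockSites L y)
    {U₀ : Site d → Fin d → 𝔸ˣ} {u₁ : Site d → 𝔸ˣ} (h129 : Restr129 L m (Λs m) U₀ u₁) :
    Restr129 L (m + 1) (Λs (m + 1)) U₀ u₁ :=
  restr129_of_cond168 hL ((restr129_truncate_iff_cond168 (Λ := Λs (m + 1)) (Λ' := Λs m) hlt htop U₀ u₁).1 h129)

end Lift

/-! ## §6 Small geometry: the JOIN's bond sets `Eb j := {b | SideTouches (Ω j) b}` -/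

section Bonds

/-- For `d ≥ 2` and `x ∈ Ω_j`, both bonds `⟨x, x + e_μ⟩` and `⟨x − e_μ, x⟩` are sides of plaquettes touching `Ω_j` (the JOIN's `hEbΩ`).
[cite: Balaban1985RegularSpaces, p.77 (convention before (1.5))] -/
theorem sideTouches_pair_of_mem (hd2 : 2 ≤ d) {Ω : Set (Site d)} {x : Site d} (hx : x ∈ Ω) (μ : Fin d) :
    SideTouches Ω x μ ∧ SideTouches Ω (x - e μ) μ := by
  haveI : Nontrivial (Fin d) := Fin.nontrivial_iff_two_le.mpr hd2
  obtain ⟨κ, hκ⟩ := exists_ne μ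
  exact ⟨sideTouches_of_bondTouches hκ (Or.inl hx),
    sideTouches_of_bondTouches hκ (Or.inr (by rw [sub_add_cancel]; exact hx))⟩

/-- For `d ≥ 2`, a bond with both end-points in a tower `Bʲ(y) ⊂ Ω_j` is a side of a plaquette touching `Ω_j` (the JOIN's `hEbT`).
[cite: Balaban1985RegularSpaces, p.77 (convention before (1.5)), (1.6) p.77] -/
theorem sideTouches_of_tower_bond (hd2 : 2 ≤ d) {L k : ℕ} {Ω : ℕ → Set (Site d)} {Λs : ℕ → Set (Site d)}
    (htower : ∀ j, j ≤ k → ∀ y ∈ Λs j, ∀ x, InBox (tlo L y j) (thi L y j) x → x ∈ Ω j)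
    {j : ℕ} (hj : j ≤ k) {y : Site d} (hy : y ∈ Λs j) (x : Site d) (κ : Fin d) (hx : InBox (tlo L y j) (thi L y j) x) :
    SideTouches (Ω j) x κ :=
  (sideTouches_pair_of_mem hd2 (htower j hj y hy x hx) κ).1

end Bonds

/-! ## §7 (v1.1) THE REMAINING DATUM BINDERS OF THE JOIN at `k := m + 1` — `h33`, `hP`, `h69`, `hA` — with `cB = cA = L·c⋆`

For the Sect. D/E assembly `B8Prop5JoinSectELocal.hFP_kLevel_of_sectE_local'` run at `m + 1` levels for the structure `Λs (m+1)` on the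
datum of `SockHFP` at level `m` (REBALANCE №49, INTERFACE-1): the four scalar/plaquette binders it displays on the datum side, read off the
socket's antecedents and the masked exponent of §2.  On `Ω_{m+1} ⊂ Ω_m` only the level-`m` bound of the datum is available, whence the
factor `L` (p. 88 «It is clear from (1.69) that we have to improve the bounds on the domain Ω_k»). -/

section JoinDatum

variable {𝔸 : Type*} [CStarAlgebra 𝔸] [Nontrivial 𝔸]

omit [Nontrivial 𝔸] in
/-- **JOIN's `h33`** (plaquette regularity of the background on the towers of `Λs (m+1)`): from (1.33) `U₀ ∈ 𝔄_K({Ω_j}, α₀)` and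
«`Bʲ(y) ⊂ Ω_j`». [cite: Balaban1985RegularSpaces, (1.7) p.77, (1.33) p.82] -/
theorem h33_of_inAk {L : ℕ} (hL : 1 ≤ L) {K : ℕ} {η α₀ : ℝ} (hα₀ : 0 < α₀) {Ω : ℕ → Set (Site d)} {U₀ : Site d → Fin d → 𝔸ˣ}
    (h33 : InAk L K η α₀ Ω U₀) {m : ℕ} (hmK : m + 1 ≤ K) {Λ : ℕ → Set (Site d)}
    (htower : ∀ j, j ≤ m + 1 → ∀ y ∈ Λ j, ∀ x, InBox (tlo L y j) (thi L y j) x → x ∈ Ω j) :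
    ∀ j, j ≤ m + 1 → ∀ y ∈ Λ j, pdevOn (tlo L y j) (thi L y j) U₀ < α₀ * (((L : ℝ) ^ j)⁻¹) ^ 2 :=
  fun j hj y hy => B8Thm4AtLandau138.pdevOn_tower_lt_of_inAk hL hα₀ h33 (hj.trans hmK) (htower j hj y hy)

/-- **JOIN's `hP`** (plaquette regularity of `e^{iηA′}U₀` on the towers, `αP := α₀`): `U₁U₀ = (U′U₀)^{u₁⁻¹} ∈ 𝔄` by gauge invariance,
`e^{iηA′} = U₁` on the sides of the plaquettes touching `Ω_j` for every `j ≤ m + 1` (those of `Ω_{m+1}` touch `Ω_m`), locality of `𝔄`.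
[cite: Balaban1985RegularSpaces, (1.7) p.77, (1.11) p.77 (gauge invariance), (1.34) p.82, (1.69) p.88] -/
theorem hP_of_datum {L : ℕ} (hL : 1 ≤ L) {K : ℕ} {η α₀ : ℝ} (hα₀ : 0 < α₀) {Ω : ℕ → Set (Site d)} (hΩ : ∀ j, Ω (j + 1) ⊆ Ω j)
    {U₀ U' : Site d → Fin d → 𝔸ˣ} (h34 : InAk L K η α₀ Ω (mulCfg U' U₀)) {m : ℕ} (hmK : m + 1 ≤ K) {Λ : ℕ → Set (Site d)}
    (htower : ∀ j, j ≤ m + 1 → ∀ y ∈ Λ j, ∀ x, InBox (tlo L y j) (thi L y j) x → x ∈ Ω j)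
    {u₁ : Site d → 𝔸ˣ} {U₁ : Site d → Fin d → 𝔸ˣ} {A' : Site d → Fin d → 𝔸} (hu₁ : ∀ x, u₁ x ∈ unitaryUnits 𝔸)
    (hW : mgauge U₀ u₁ U₁ = U') (hWA : ∀ j, j ≤ m → ∀ (y : Site d) (τ : Fin d), SideTouches (Ω j) y τ → U₁ y τ = cfgExp η A' y τ) :
    ∀ j, j ≤ m + 1 → ∀ y ∈ Λ j,
      pdevOn (tlo L y j) (thi L y j) (expCfg (iEta η A') * U₀) < α₀ * (((L : ℝ) ^ j)⁻¹) ^ 2 := by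
  have h34W : InAk L (m + 1) η α₀ Ω (mulCfg U₁ U₀) := by
    have h1 : InAk L (m + 1) η α₀ Ω (mulCfg U' U₀) := fun j hj => h34 j (hj.trans hmK)
    have hui : ∀ x, u₁⁻¹ x ∈ U1 𝔸 := fun x => unitaryUnits_le_U1 ((unitaryUnits 𝔸).inv_mem (hu₁ x))
    rw [mulCfg_eq_gaugeAct_of_mgauge_eq hW]
    exact (B8Ineq132.inAk_gaugeAct_iff L (m + 1) η α₀ Ω hui _).2 h1
  -- `e^{iηA′} = U₁` on the sides of the plaquettes touching `Ω_j`, `j ≤ m + 1`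
  have hagree : ∀ j, j ≤ m + 1 → ∀ (y : Site d) (τ : Fin d), SideTouches (Ω j) y τ →
      mulCfg U₁ U₀ y τ = mulCfg (expCfg (iEta η A')) U₀ y τ := by
    intro j hj y τ hs
    have hs' : ∃ j', j' ≤ m ∧ SideTouches (Ω j') y τ := by
      rcases Nat.lt_or_ge j (m + 1) with hjm | hjm
      · exact ⟨j, by omega, hs⟩
      · obtain rfl : j = m + 1 := le_antisymm hj hjm
        exact ⟨m, le_rfl, B8Eq140Level.sideTouches_mono (hΩ m) hs⟩
    obtain ⟨j', hj', hs''⟩ := hs'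
    show U₁ y τ * U₀ y τ = expCfg (iEta η A') y τ * U₀ y τ
    rw [hWA j' hj' y τ hs'', expCfg_iEta_eq_cfgExp]
  have h40₁ : InAk L (m + 1) η α₀ Ω (mulCfg (expCfg (iEta η A')) U₀) :=
    (inAk_congr_of_sideTouches L (m + 1) η α₀ (V := mulCfg U₁ U₀) hagree).1 h34W
  intro j hj y hy
  exact B8Thm4AtLandau138.pdevOn_tower_lt_of_inAk hL hα₀ h40₁ hj (htower j hj y hy)

omit [Nontrivial 𝔸] in
/-- **JOIN's `h69`** (the exponent `B = iηA′` on the tower bonds, `cB := L·c⋆`): `‖iηA′(x, κ)‖ ≤ L·c·(Lʲ)⁻¹` for every bond with both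
end-points in a tower `Bʲ(y) ⊂ Ω_j`, `y ∈ Λs (m+1) j`, `j ≤ m + 1`, from `‖A′‖ ≤ c(Lʲ′η)⁻¹` on the sides of the plaquettes touching `Ω_j′`,
`j′ ≤ m` (for `j = m + 1` through `Ω_{m+1} ⊂ Ω_m`: `c(L^m)⁻¹ = L·c·(L^{m+1})⁻¹`). [cite: Balaban1985RegularSpaces, (1.69) p.88] -/
theorem h69_of_datum (hd2 : 2 ≤ d) {L : ℕ} (hL : 1 ≤ L) {η : ℝ} (hη : 0 < η) {Ω : ℕ → Set (Site d)} (hΩ : ∀ j, Ω (j + 1) ⊆ Ω j)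
    {m : ℕ} {Λ : ℕ → Set (Site d)} (htower : ∀ j, j ≤ m + 1 → ∀ y ∈ Λ j, ∀ x, InBox (tlo L y j) (thi L y j) x → x ∈ Ω j)
    {A' : Site d → Fin d → 𝔸} {c : ℝ} (hc : 0 ≤ c)
    (h41 : ∀ j, j ≤ m → ∀ (y : Site d) (τ : Fin d), SideTouches (Ω j) y τ → ‖A' y τ‖ ≤ c * ((L : ℝ) ^ j * η)⁻¹) :
    ∀ j, j ≤ m + 1 → ∀ y ∈ Λ j, ∀ (x : Site d) (κ : Fin d), InBox (tlo L y j) (thi L y j) x →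
      InBox (tlo L y j) (thi L y j) (x + e κ) → ‖iEta η A' x κ‖ ≤ (L * c) * ((L : ℝ) ^ j)⁻¹ := by
  have hLr : (1 : ℝ) ≤ L := by exact_mod_cast hL
  intro j hj y hy x κ hx _
  have hxΩ : x ∈ Ω j := htower j hj y hy x hx
  -- the norm of `iηA′`
  have hnorm : ‖iEta η A' x κ‖ = η * ‖A' x κ‖ := by
    show ‖((I : ℂ) * η) • A' x κ‖ = η * ‖A' x κ‖
    rw [norm_smul, norm_mul, Complex.norm_I, one_mul, Complex.norm_real, Real.norm_eq_abs, abs_of_pos hη]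
  rw [hnorm]
  rcases Nat.lt_or_ge j (m + 1) with hjm | hjm
  · -- `j ≤ m`: the bond touches `Ω_j`
    have hs : SideTouches (Ω j) x κ := (sideTouches_pair_of_mem hd2 hxΩ κ).1
    have hb := h41 j (by omega) x κ hs
    have hLj : (0 : ℝ) < (L : ℝ) ^ j := by positivity
    calc η * ‖A' x κ‖ ≤ η * (c * ((L : ℝ) ^ j * η)⁻¹) := mul_le_mul_of_nonneg_left hb hη.le
      _ = c * ((L : ℝ) ^ j)⁻¹ := by field_simp
      _ ≤ L * c * ((L : ℝ) ^ j)⁻¹ := by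
          have : c ≤ L * c := le_mul_of_one_le_left hc hLr
          exact mul_le_mul_of_nonneg_right this (by positivity)
  · -- `j = m + 1`: the bond touches `Ω_m ⊃ Ω_{m+1}`
    obtain rfl : j = m + 1 := le_antisymm hj hjm
    have hs : SideTouches (Ω m) x κ := (sideTouches_pair_of_mem hd2 (hΩ m hxΩ) κ).1
    have hb := h41 m le_rfl x κ hs
    calc η * ‖A' x κ‖ ≤ η * (c * ((L : ℝ) ^ m * η)⁻¹) := mul_le_mul_of_nonneg_left hb hη.le
      _ = c * ((L : ℝ) ^ m)⁻¹ := by field_simp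
      _ = L * c * ((L : ℝ) ^ (m + 1))⁻¹ := by rw [pow_succ]; field_simp

/-- **JOIN's `hA`** (the `(−1)`-weighted size of `A′` and of its transported neighbour at the sites of `Ω_j`, `cA := L·c⋆`): for `x ∈ Ω_j`,
`j ≤ m + 1`, and every `μ`, `Lʲη·‖A′(x, μ)‖ ≤ L·c` and `Lʲη·‖R(U₀(x − e_μ, μ))⁻¹A′(x − e_μ, μ)‖ ≤ L·c` (both bonds touch `Ω_j`; unitary
transport is isometric; `j = m + 1` through `Ω_{m+1} ⊂ Ω_m`). [cite: Balaban1985RegularSpaces, (1.69) p.88, (1.102) p.93] -/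
theorem hA_of_datum (hd2 : 2 ≤ d) {L : ℕ} (hL : 1 ≤ L) {η : ℝ} (hη : 0 < η) {Ω : ℕ → Set (Site d)} (hΩ : ∀ j, Ω (j + 1) ⊆ Ω j)
    {m : ℕ} {U₀ : Site d → Fin d → 𝔸ˣ} (hU₀ : ∀ x κ, U₀ x κ ∈ unitaryUnits 𝔸) {A' : Site d → Fin d → 𝔸} {c : ℝ} (hc : 0 ≤ c)
    (h41 : ∀ j, j ≤ m → ∀ (y : Site d) (τ : Fin d), SideTouches (Ω j) y τ → ‖A' y τ‖ ≤ c * ((L : ℝ) ^ j * η)⁻¹) :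
    ∀ j, j ≤ m + 1 → ∀ x ∈ Ω j, ∀ μ : Fin d,
      wt L η j * ‖A' x μ‖ ≤ L * c ∧ wt L η j * ‖conjR (U₀ (x - e μ) μ)⁻¹ (A' (x - e μ) μ)‖ ≤ L * c := by
  have hLr : (1 : ℝ) ≤ L := by exact_mod_cast hL
  have hU₀1 : ∀ x κ, U₀ x κ ∈ U1 𝔸 := fun x κ => unitaryUnits_le_U1 (hU₀ x κ)
  -- the level-`j′` bound at a bond touching `Ω_j′`, `j′ ≤ m`, in weighted form
  have key : ∀ j', j' ≤ m → ∀ (y : Site d) (τ : Fin d), SideTouches (Ω j') y τ → wt L η j' * ‖A' y τ‖ ≤ c := by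
    intro j' hj' y τ hs
    have hw : 0 < wt L η j' := B8LambdaSpaceKLevel.wt_pos hL hη j'
    have h := mul_le_mul_of_nonneg_left (h41 j' hj' y τ hs) hw.le
    have e : wt L η j' * (c * ((L : ℝ) ^ j' * η)⁻¹) = c := by unfold wt; field_simp
    rwa [e] at h
  intro j hj x hx μ
  rw [norm_conjR ((U1 𝔸).inv_mem (hU₀1 _ _))]
  rcases Nat.lt_or_ge j (m + 1) with hjm | hjm
  · have hjm' : j ≤ m := by omega
    obtain ⟨hs₁, hs₂⟩ := sideTouches_pair_of_mem hd2 hx μ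
    have h₁ := key j hjm' x μ hs₁
    have h₂ := key j hjm' (x - e μ) μ hs₂
    have hcL : c ≤ L * c := le_mul_of_one_le_left hc hLr
    exact ⟨h₁.trans hcL, h₂.trans hcL⟩
  · obtain rfl : j = m + 1 := le_antisymm hj hjm
    obtain ⟨hs₁, hs₂⟩ := sideTouches_pair_of_mem hd2 (hΩ m hx) μ
    have h₁ := key m le_rfl x μ hs₁
    have h₂ := key m le_rfl (x - e μ) μ hs₂
    have hw : wt L η (m + 1) = L * wt L η m := by unfold wt; rw [pow_succ]; ring
    have hwm : 0 ≤ wt L η m := B8LambdaSpaceKLevel.wt_nonneg L hη.le m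
    rw [hw, mul_assoc, mul_assoc]
    exact ⟨mul_le_mul_of_nonneg_left h₁ (by positivity), mul_le_mul_of_nonneg_left h₂ (by positivity)⟩

end JoinDatum

end Literature.MathematicalPhysics.QuantumFieldTheory.Balaban1983to89.B8Prop5SocketDatum

end
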